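import Summits.ABC.ABC.Theorems.PrimePowerRadical.Negative.WieferichSparse
import Summits.ABC.ABC.Theorems.PrimePowerRadical.Negative.NonWieferich
import Summits.ABC.ABC.Theorems.PrimePowerRadical.Negative.DoubleWall
import Summits.ABC.ABC.Theorems.PrimePowerRadical.Negative.Orders

/-!
# Strategy census companion — crux stmt-ABC-1648 `PrimePowerRadical` (crux-strategist, wall-breaker seat, 2026-08-17)

Lean companion of `Cruxes/PrimePowerRadical/STRATEGY-CENSUS.md` (§ Decomposition). Everything here is
sorry-free and uses only landed `Negative/*` theorems.

THE LEVEL SPLIT. Write the odd Wieferich excess `E_W(q,k) = ∏_{p ∣ q^k−1, p odd} p^{W_p(q)−1}` as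
`E₂(q,k) · E₃(q,k)` with `E₂ := ∏_{W_p = 2} p` (the level-2 = "generic Wieferich" part) and
`E₃ := ∏_{W_p ≥ 3} p^{W_p − 1}` (the high-level part) — `oddWieferichExcess_eq_mul`. The crux at `q`
(⟺ `WieferichSparse q`, landed) is then EQUIVALENT to the conjunction of
* `LevelTwoSparse q`  : `∀ε ∃C ∀k≥1, E₂(q,k) < C q^{εk}`,
* `HighLevelSparse q` : `∀ε ∃C ∀k≥1, E₃(q,k) < C q^{εk}`
(`primePowerRadical_iff_levelSplit`; lossless in both directions).

WHY THIS SPLIT IS RECORDED. Every line of the exhausted chain died because its concluding stub was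
kernel-certified to be `≥ crux(q)` or `≥` Silverman's conclusion "infinitely many non-Wieferich primes base q"
(the 1909 WALL; `Negative.primePowerRadical_imp_infinite_nonWieferich`). Here NEITHER half is `≥` the wall:
`rungTwo_of_levelTwoSparse_imp_wall` certifies that any proof of `LevelTwoSparse q → Wall q` is a proof of
RUNG 2 of the level ladder (`{p : W_p(q) ≤ 2}` infinite — open for every base, BarrierNotes-r1-k2 B1), because in
the (unrefuted) world "every large prime has level ≥ 3" the level-2 half holds trivially while the wall fails.
So the wall lives only in the CONJUNCTION. This is the one structural novelty the strategist found; it has no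
engine behind either half (census § Decomposition says why), hence it is recorded as a calibration, not
registered as a line.
-/

noncomputable section

namespace Summit.ABC.ABC.Cruxes.PrimePowerRadical.StrategyCensus

open Literature.NumberTheory.DiophantineGeometry UniqueFactorizationMonoid
open Summit.ABC.ABC.Theses.IneffectiveSubspace
open Summit.ABC.ABC.Theorems.PrimePowerRadical.Negative

/-! ## §1 The two halves of the odd Wieferich excess -/

/-- Level-2 part of the odd Wieferich excess of `q^k − 1`: the product of the odd primes `p ∣ q^k − 1` of
Wieferich level exactly `2` (each contributes `p^{2−1} = p` to `E_W`). [folklore] -/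
def levelTwoExcess (q k : ℕ) : ℕ :=
  ∏ p ∈ ((q ^ k - 1).primeFactors.erase 2).filter (fun p => wieferichLevel q p = 2), p

/-- High-level part of the odd Wieferich excess of `q^k − 1`: `∏_{p ∣ q^k−1, p odd, W_p(q) ≥ 3} p^{W_p − 1}`.
[folklore] -/
def highLevelExcess (q k : ℕ) : ℕ :=
  ∏ p ∈ ((q ^ k - 1).primeFactors.erase 2).filter (fun p => 3 ≤ wieferichLevel q p),
    p ^ (wieferichLevel q p - 1)

/-- `LevelTwoSparse q`: the level-2 Wieferich primes to base `q` dividing `q^k − 1` have log-mass `o(k)`.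
[folklore] -/
def LevelTwoSparse (q : ℕ) : Prop :=
  ∀ ε : ℝ, 0 < ε → ∃ C : ℝ, 0 < C ∧ ∀ k : ℕ, 1 ≤ k → (levelTwoExcess q k : ℝ) < C * (q : ℝ) ^ (ε * k)

/-- `HighLevelSparse q`: the primes of level `≥ 3` dividing `q^k − 1`, weighted by `(W_p − 1) log p`, have
mass `o(k)`. [folklore] -/
def HighLevelSparse (q : ℕ) : Prop :=
  ∀ ε : ℝ, 0 < ε → ∃ C : ℝ, 0 < C ∧ ∀ k : ℕ, 1 ≤ k → (highLevelExcess q k : ℝ) < C * (q : ℝ) ^ (ε * k)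

theorem levelTwoExcess_pos (q k : ℕ) : 0 < levelTwoExcess q k := by
  unfold levelTwoExcess
  exact Finset.prod_pos fun p hp =>
    (Nat.prime_of_mem_primeFactors (Finset.mem_of_mem_erase (Finset.mem_filter.mp hp).1)).pos

theorem highLevelExcess_pos (q k : ℕ) : 0 < highLevelExcess q k := by
  unfold highLevelExcess
  exact Finset.prod_pos fun p hp =>
    pow_pos (Nat.prime_of_mem_primeFactors (Finset.mem_of_mem_erase (Finset.mem_filter.mp hp).1)).pos _

/-- **The split identity** `E_W(q,k) = E₂(q,k) · E₃(q,k)` (primes of level `≤ 1` contribute `p^0 = 1`).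
[folklore] -/
theorem oddWieferichExcess_eq_mul (q k : ℕ) :
    oddWieferichExcess q k = levelTwoExcess q k * highLevelExcess q k := by
  classical
  unfold oddWieferichExcess levelTwoExcess highLevelExcess
  set S := (q ^ k - 1).primeFactors.erase 2 with hS
  rw [← Finset.prod_filter_mul_prod_filter_not S (fun p => wieferichLevel q p = 2)]
  congr 1
  · refine Finset.prod_congr rfl fun p hp => ?_
    rw [(Finset.mem_filter.mp hp).2]
    simp
  · rw [← Finset.prod_filter_mul_prod_filter_not (S.filter fun p => ¬ wieferichLevel q p = 2)
      (fun p => 3 ≤ wieferichLevel q p)]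
    have h1 : (S.filter fun p => ¬ wieferichLevel q p = 2).filter (fun p => 3 ≤ wieferichLevel q p) =
        S.filter (fun p => 3 ≤ wieferichLevel q p) := by
      rw [Finset.filter_filter]
      refine Finset.filter_congr fun p _ => ⟨fun h => h.2, fun h => ⟨by omega, h⟩⟩
    have h2 : ∏ p ∈ (S.filter fun p => ¬ wieferichLevel q p = 2).filter
        (fun p => ¬ 3 ≤ wieferichLevel q p), p ^ (wieferichLevel q p - 1) = 1 := by
      refine Finset.prod_eq_one fun p hp => ?_
      rw [Finset.mem_filter, Finset.mem_filter] at hp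
      have : wieferichLevel q p - 1 = 0 := by omega
      rw [this, pow_zero]
    rw [h1, h2, mul_one]

theorem levelTwoExcess_le (q k : ℕ) : levelTwoExcess q k ≤ oddWieferichExcess q k := by
  rw [oddWieferichExcess_eq_mul]
  exact Nat.le_mul_of_pos_right _ (highLevelExcess_pos q k)

theorem highLevelExcess_le (q k : ℕ) : highLevelExcess q k ≤ oddWieferichExcess q k := by
  rw [oddWieferichExcess_eq_mul]
  exact Nat.le_mul_of_pos_left _ (levelTwoExcess_pos q k)

/-! ## §2 The split is lossless: crux(q) ⟺ LevelTwoSparse q ∧ HighLevelSparse q -/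

/-- Both halves sparse ⟹ Wieferich sparsity at `q` (take `ε/2` twice and multiply). [folklore] -/
theorem wieferichSparse_of_levelSplit {q : ℕ} (hq : 1 ≤ q) (h2 : LevelTwoSparse q)
    (h3 : HighLevelSparse q) :
    ∀ ε : ℝ, 0 < ε → ∃ C : ℝ, 0 < C ∧ ∀ k : ℕ, 1 ≤ k →
      (oddWieferichExcess q k : ℝ) < C * (q : ℝ) ^ (ε * k) := by
  intro ε hε
  obtain ⟨C₂, hC₂, hE₂⟩ := h2 (ε / 2) (by positivity)
  obtain ⟨C₃, hC₃, hE₃⟩ := h3 (ε / 2) (by positivity)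
  refine ⟨C₂ * C₃, by positivity, fun k hk => ?_⟩
  have hq0 : (0 : ℝ) < q := by exact_mod_cast hq
  have e2 := hE₂ k hk
  have e3 := hE₃ k hk
  have hsplit : (oddWieferichExcess q k : ℝ) = (levelTwoExcess q k : ℝ) * (highLevelExcess q k : ℝ) := by
    rw [oddWieferichExcess_eq_mul]; push_cast; ring
  have hpow : (q : ℝ) ^ (ε / 2 * k) * (q : ℝ) ^ (ε / 2 * k) = (q : ℝ) ^ (ε * k) := by
    rw [← Real.rpow_add hq0]; ring_nf
  calc (oddWieferichExcess q k : ℝ)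
      = (levelTwoExcess q k : ℝ) * (highLevelExcess q k : ℝ) := hsplit
    _ < (C₂ * (q : ℝ) ^ (ε / 2 * k)) * (C₃ * (q : ℝ) ^ (ε / 2 * k)) :=
        mul_lt_mul'' e2 e3 (Nat.cast_nonneg _) (Nat.cast_nonneg _)
    _ = C₂ * C₃ * ((q : ℝ) ^ (ε / 2 * k) * (q : ℝ) ^ (ε / 2 * k)) := by ring
    _ = C₂ * C₃ * (q : ℝ) ^ (ε * k) := by rw [hpow]

/-- Wieferich sparsity at `q` ⟹ both halves sparse (each half divides `E_W`). [folklore] -/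
theorem levelSplit_of_wieferichSparse {q : ℕ}
    (h : ∀ ε : ℝ, 0 < ε → ∃ C : ℝ, 0 < C ∧ ∀ k : ℕ, 1 ≤ k →
      (oddWieferichExcess q k : ℝ) < C * (q : ℝ) ^ (ε * k)) :
    LevelTwoSparse q ∧ HighLevelSparse q := by
  constructor
  · intro ε hε
    obtain ⟨C, hC, hE⟩ := h ε hε
    refine ⟨C, hC, fun k hk => lt_of_le_of_lt ?_ (hE k hk)⟩
    exact_mod_cast levelTwoExcess_le q k
  · intro ε hε
    obtain ⟨C, hC, hE⟩ := h ε hε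
    refine ⟨C, hC, fun k hk => lt_of_le_of_lt ?_ (hE k hk)⟩
    exact_mod_cast highLevelExcess_le q k

/-- **The glue of the level split**: both halves at every prime base ⟹ `PrimePowerRadical`. [folklore] -/
theorem primePowerRadical_of_levelSplit (h2 : ∀ q : ℕ, q.Prime → LevelTwoSparse q)
    (h3 : ∀ q : ℕ, q.Prime → HighLevelSparse q) : PrimePowerRadical :=
  primePowerRadical_iff_wieferichSparse.mpr fun q hq =>
    wieferichSparse_of_levelSplit hq.one_lt.le (h2 q hq) (h3 q hq)

/-- **The split is lossless**: `PrimePowerRadical ⟺ (∀ q prime, LevelTwoSparse q) ∧ (∀ q prime, HighLevelSparse q)`.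
[folklore] -/
theorem primePowerRadical_iff_levelSplit :
    PrimePowerRadical ↔ (∀ q : ℕ, q.Prime → LevelTwoSparse q) ∧ (∀ q : ℕ, q.Prime → HighLevelSparse q) := by
  constructor
  · intro h
    have hW := primePowerRadical_iff_wieferichSparse.mp h
    exact ⟨fun q hq => (levelSplit_of_wieferichSparse (hW q hq)).1,
      fun q hq => (levelSplit_of_wieferichSparse (hW q hq)).2⟩
  · rintro ⟨h2, h3⟩
    exact primePowerRadical_of_levelSplit h2 h3

/-! ## §3 The level-2 half is WALL-FREE (certified relative to rung 2 of the level ladder) -/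

/-- Rung 2 of the Wieferich level ladder at base `q`: infinitely many primes of level `≤ 2`
(i.e. with `q^{p−1} ≢ 1 (mod p³)`). Implied by the crux (`Negative.primePowerRadical_imp_infinite_level_le`);
OPEN for every base `q ≥ 2` (BarrierNotes-r1-k2 B1: Yu/Stewart exclude only levels `≥ p^{1−o(1)}`). [folklore] -/
def RungTwo (q : ℕ) : Prop := {p : ℕ | p.Prime ∧ wieferichLevel q p ≤ 2}.Infinite

/-- In the world `¬ RungTwo q` (all but finitely many primes have level `≥ 3`) the level-2 excess is bounded.
[folklore] -/
theorem levelTwoExcess_bounded_of_not_rungTwo {q : ℕ} (h : ¬ RungTwo q) :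
    ∃ B : ℕ, ∀ k : ℕ, levelTwoExcess q k ≤ B := by
  have hfin : {p : ℕ | p.Prime ∧ wieferichLevel q p ≤ 2}.Finite := Set.not_infinite.mp h
  obtain ⟨N, hN⟩ := hfin.bddAbove
  refine ⟨∏ p ∈ (Finset.range (N + 1)).filter Nat.Prime, p, fun k => ?_⟩
  unfold levelTwoExcess
  apply Finset.prod_le_prod_of_subset_of_one_le'
  · intro p hp
    rw [Finset.mem_filter] at hp ⊢
    obtain ⟨hpS, hp2⟩ := hp
    have hp : p.Prime := Nat.prime_of_mem_primeFactors (Finset.mem_of_mem_erase hpS)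
    have hle : p ≤ N := hN ⟨hp, by omega⟩
    exact ⟨Finset.mem_range.mpr (by omega), hp⟩
  · intro p hp _
    exact (Finset.mem_filter.mp hp).2.pos

/-- … hence `LevelTwoSparse q` holds trivially in that world. [folklore] -/
theorem levelTwoSparse_of_not_rungTwo {q : ℕ} (hq : 1 ≤ q) (h : ¬ RungTwo q) : LevelTwoSparse q := by
  obtain ⟨B, hB⟩ := levelTwoExcess_bounded_of_not_rungTwo h
  intro ε hε
  refine ⟨B + 1, by positivity, fun k hk => ?_⟩
  have h1 : (levelTwoExcess q k : ℝ) ≤ B := by exact_mod_cast hB k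
  have hq1 : (1 : ℝ) ≤ q := by exact_mod_cast hq
  have h2 : (1 : ℝ) ≤ (q : ℝ) ^ (ε * k) := Real.one_le_rpow hq1 (by positivity)
  have h3 : (0 : ℝ) < (B : ℝ) + 1 := by positivity
  calc (levelTwoExcess q k : ℝ) < B + 1 := by linarith
    _ = ((B : ℝ) + 1) * 1 := by ring
    _ ≤ ((B : ℝ) + 1) * (q : ℝ) ^ (ε * k) := mul_le_mul_of_nonneg_left h2 h3.le

/-- … while Silverman's conclusion FAILS in that world: every odd prime `p ∤ q` of level `≥ 3 ≥ 2` is Wieferich,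
so the non-Wieferich primes lie in the finite set `{level ≤ 2} ∪ {2} ∪ primeFactors q`. [folklore] -/
theorem finite_nonWieferich_of_not_rungTwo {q : ℕ} (hq : 2 ≤ q) (h : ¬ RungTwo q) :
    {p : ℕ | p.Prime ∧ ¬ IsWieferich q p}.Finite := by
  have hfin : {p : ℕ | p.Prime ∧ wieferichLevel q p ≤ 2}.Finite := Set.not_infinite.mp h
  have hbig : ({p : ℕ | p.Prime ∧ wieferichLevel q p ≤ 2} ∪ ({2} ∪ (q.primeFactors : Set ℕ))).Finite :=
    hfin.union ((Set.finite_singleton 2).union q.primeFactors.finite_toSet)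
  refine hbig.subset ?_
  rintro p ⟨hp, hw⟩
  by_cases hp2 : p = 2
  · exact Or.inr (Or.inl hp2)
  by_cases hpq : p ∣ q
  · exact Or.inr (Or.inr (Finset.mem_coe.mpr (Nat.mem_primeFactors.mpr ⟨hp, hpq, by omega⟩)))
  · refine Or.inl ⟨hp, ?_⟩
    rw [isWieferich_iff_two_le_wieferichLevel hq hp hp2 hpq] at hw
    omega

/-- **WALL-FREENESS CERTIFICATE for the level-2 half.** Any proof that `LevelTwoSparse q` implies
"infinitely many non-Wieferich primes base `q`" (the 1909 wall, which the crux itself DOES imply: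
`Negative.primePowerRadical_imp_infinite_nonWieferich`) is a proof of rung 2 at `q` — open for every base.
Contrast: the crux at `q`, the tower bet, WDC(q), the level-2 bet `μ < 1/2`, CyclotomicRadical(q) and
SquarefreeKernelLarge(q) (the concluding stubs of the four dead lines and the four failed cards) all imply the wall
outright. [folklore] -/
theorem rungTwo_of_levelTwoSparse_imp_wall {q : ℕ} (hq : 2 ≤ q)
    (h : LevelTwoSparse q → {p : ℕ | p.Prime ∧ ¬ IsWieferich q p}.Infinite) : RungTwo q := by
  by_contra hR
  exact h (levelTwoSparse_of_not_rungTwo (by omega) hR) (finite_nonWieferich_of_not_rungTwo hq hR)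

/-- The crux at `q` is NOT wall-free (landed): it implies Silverman's conclusion at `q`. Recorded here next to
the certificate for contrast. [folklore] -/
theorem wall_of_crux {q : ℕ} (hq : q.Prime)
    (h : ∀ ε : ℝ, 0 < ε → ∃ C : ℝ, 0 < C ∧ ∀ k : ℕ, 1 ≤ k →
      ((q ^ k : ℕ) : ℝ) < C * ((rad 1 (q ^ k - 1) (q ^ k) : ℕ) : ℝ) ^ (1 + ε)) :
    {p : ℕ | p.Prime ∧ ¬ IsWieferich q p}.Infinite :=
  infinite_nonWieferich_of_wieferichSparse hq (wieferichSparse_of_PPRAt hq h)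

/-! ## §4 The high-level half in the heuristically-true world `FinHighLevel` -/

/-- `FinHighLevel q`: only finitely many primes have Wieferich level `≥ 3` to base `q` (heuristic count
`Σ_p p^{−2} < ∞`; every known Wieferich prime to a prime base `≤ 47` has level `2` except `W_7(19) = 3`).
NOT implied by `ABC`; no rung of it is known either. [folklore] -/
def FinHighLevel (q : ℕ) : Prop := {p : ℕ | p.Prime ∧ 3 ≤ wieferichLevel q p}.Finite

/-- `FinHighLevel q ⟹ HighLevelSparse q` (bounded high-level excess). So in the expected world the whole content
of the crux at `q` is `LevelTwoSparse q` — the wall-free half. [folklore] -/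
theorem highLevelSparse_of_finHighLevel {q : ℕ} (hq : 1 ≤ q) (h : FinHighLevel q) : HighLevelSparse q := by
  obtain ⟨N, hN⟩ := h.bddAbove
  have hB : ∀ k : ℕ, highLevelExcess q k ≤
      ∏ p ∈ (Finset.range (N + 1)).filter Nat.Prime, p ^ (wieferichLevel q p - 1) := by
    intro k
    unfold highLevelExcess
    apply Finset.prod_le_prod_of_subset_of_one_le'
    · intro p hp
      rw [Finset.mem_filter] at hp ⊢
      obtain ⟨hpS, hp3⟩ := hp
      have hp : p.Prime := Nat.prime_of_mem_primeFactors (Finset.mem_of_mem_erase hpS)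
      have hle : p ≤ N := hN ⟨hp, hp3⟩
      exact ⟨Finset.mem_range.mpr (by omega), hp⟩
    · intro p hp _
      exact Nat.one_le_pow _ _ (Finset.mem_filter.mp hp).2.pos
  set B := ∏ p ∈ (Finset.range (N + 1)).filter Nat.Prime, p ^ (wieferichLevel q p - 1) with hBdef
  intro ε hε
  refine ⟨B + 1, by positivity, fun k hk => ?_⟩
  have h1 : (highLevelExcess q k : ℝ) ≤ B := by exact_mod_cast hB k
  have hq1 : (1 : ℝ) ≤ q := by exact_mod_cast hq
  have h2 : (1 : ℝ) ≤ (q : ℝ) ^ (ε * k) := Real.one_le_rpow hq1 (by positivity)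
  have h3 : (0 : ℝ) < (B : ℝ) + 1 := by positivity
  calc (highLevelExcess q k : ℝ) < B + 1 := by linarith
    _ = ((B : ℝ) + 1) * 1 := by ring
    _ ≤ ((B : ℝ) + 1) * (q : ℝ) ^ (ε * k) := mul_le_mul_of_nonneg_left h2 h3.le

/-- Hence, GIVEN `FinHighLevel` at every prime base, the crux is exactly the wall-free statement
`∀ q prime, LevelTwoSparse q`. [folklore] -/
theorem primePowerRadical_of_levelTwoSparse_of_finHighLevel
    (hfin : ∀ q : ℕ, q.Prime → FinHighLevel q) (h2 : ∀ q : ℕ, q.Prime → LevelTwoSparse q) :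
    PrimePowerRadical :=
  primePowerRadical_of_levelSplit h2 fun q hq => highLevelSparse_of_finHighLevel hq.one_lt.le (hfin q hq)

end Summit.ABC.ABC.Cruxes.PrimePowerRadical.StrategyCensus

end
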